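import Literature.NumberTheory.LFunctions.ClassGroupLFunctionRealZeros
import HarnessLib

/-!
# The exceptional zero of a class group `L`-function is simple, uniformly in the field

Topic `Literature/NumberTheory/LFunctions` (namespace `Literature.NumberTheory.LFunctions.NumberField`),
completing `ClassGroupLFunctionZeroFreeRegion.lean` / `ClassGroupLFunctionRealZeros.lean` with the
multiplicity clause of [ThornerZaman2019, Theorem 3.1] / Montgomery–Vaughan Theorem 11.3 ("if
`β₁` exists, then it is real and simple"). Everything here is PROVED (theorems only).

The Lemma-α package of the abstract zero-free-region files does not track multiplicities, so we
use instead the local partial fraction of `Z₁_χ'/Z₁_χ` with TRUE multiplicities (Mathlib's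
`divisor` of the entire `Z₁_χ = (s − 1)L(s, χ)`, `ClassGroupLFunctionZeroCount.lean`) at height
`0`: for real `σ ∈ (1, 2]`,
`−L'/L(σ, χ) = 1/(σ − 1) − Σ_ρ m(ρ)/(σ − ρ) + O(M_K(0))`, the sum over the zeros of `Z₁_χ` in
`|ρ − 2| ≤ 31/16`, which contain `ρ = 1` (multiplicity `≥ 1`, `Z₁_χ(1) = 0` for `χ ≠ 1`) and a
real zero `β` of `L(s, χ)` of order `m ≥ 2` (multiplicity `m`). Dropping the other zeros
(`Re 1/(σ − ρ) ≥ 0`), `Re(−L'/L)(σ, χ) ≤ −2/(σ − β) + O(ℒ₀)`, and MV (11.4)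
`0 ≤ L(Λ_K, σ) + Re L(Λ_χ, σ) ≤ 1/(σ−1) + K₀ℒ₀ − 2/(σ − β) + O(ℒ₀)` at `σ = 1 + 2(1 − β)` gives
`1 − β ≫ 1/ℒ₀`, `ℒ₀ = log|d_K| + log 4`, exactly as in MV's Case 4:

* `natCast_le_divisor_of_le_analyticOrderAt` — multiplicities in the divisor;
* `analyticOrderAt_classTwistedZeta₁_eq` — `ord_β Z₁_χ = ord_β L₀(·, χ)` for `β ≠ 1`;
* `re_LSeries_twistVonMangoldt_ofReal_le_of_doubleZero` — the displayed inequality;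
* `exists_realZero_simple_classGroupLFunction₀` — **for every `n` there is `c = c(n) > 0` such that
  for every `K` of degree `n`, `χ ≠ 1` and every real zero `β` of `L₀(s, χ)` of order `≥ 2`,
  `β ≤ 1 − c/(log|d_K| + log 4)`**: an exceptional zero is simple.

## References

* H. L. Montgomery, R. C. Vaughan, *Multiplicative Number Theory I*, CUP 2007, Theorem 11.3
  (multiplicity clause; proof, Case 4). [MontgomeryVaughan2007]
* J. Thorner, A. Zaman, *A unified and improved Chebotarev density theorem*, ANT 13 (2019),
  Theorem 3.1. [ThornerZaman2019]
-/

noncomputable section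

open scoped NumberField nonZeroDivisors
open Complex Filter Topology Set Metric MeromorphicOn NumberField

namespace Literature.NumberTheory.LFunctions.NumberField

variable {K : Type*} [Field K] [NumberField K]

/-! ### Multiplicities in the divisor -/

/-- For an analytic `f` on a closed disc `U` and `z ∈ U` with `k ≤ ord_z f < ∞`, the divisor of
`f` on `U` has `D(z) ≥ k`. [folklore] -/
theorem natCast_le_divisor_of_le_analyticOrderAt {f : ℂ → ℂ} {U : Set ℂ} (hf : AnalyticOnNhd ℂ f U)
    {z : ℂ} (hz : z ∈ U) {k : ℕ} (hk : (k : ℕ∞) ≤ analyticOrderAt f z) (htop : analyticOrderAt f z ≠ ⊤) :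
    (k : ℤ) ≤ divisor f U z := by
  rw [divisor_apply hf.meromorphicOn hz, (hf z hz).meromorphicOrderAt_eq]
  obtain ⟨j, hj⟩ := ENat.ne_top_iff_exists.mp htop
  rw [← hj] at hk ⊢
  have hkj : k ≤ j := by exact_mod_cast hk
  simp only [ENat.map_coe, WithTop.untop₀_coe]
  exact_mod_cast hkj

/-- `Z₁_χ = (s − 1) · L₀(s, χ)` everywhere (`χ ≠ 1`). [folklore] -/
theorem classTwistedZeta₁_eq_sub_one_mul {χ : ClassGroup (𝓞 K) →* ℂˣ} (hχ : χ ≠ 1) :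
    classTwistedZeta₁ K (fun C ↦ (χ C : ℂ)) = fun s ↦ (s - 1) * classGroupLFunction₀ K χ s := by
  funext s
  by_cases hs : s = 1
  · rw [hs, sub_self, zero_mul, classTwistedZeta₁_one_eq_zero hχ]
  · rw [classGroupLFunction₀_eq χ hs hχ, sub_one_mul_classGroupLFunction χ hs]

/-- `ord_β Z₁_χ = ord_β L₀(·, χ)` for `β ≠ 1` (`χ ≠ 1`). [folklore] -/
theorem analyticOrderAt_classTwistedZeta₁_eq {χ : ClassGroup (𝓞 K) →* ℂˣ} (hχ : χ ≠ 1) {z : ℂ}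
    (hz : z ≠ 1) :
    analyticOrderAt (classTwistedZeta₁ K (fun C ↦ (χ C : ℂ))) z =
      analyticOrderAt (classGroupLFunction₀ K χ) z := by
  have hsub : AnalyticAt ℂ (fun s : ℂ ↦ s - 1) z := analyticAt_id.sub analyticAt_const
  rw [classTwistedZeta₁_eq_sub_one_mul hχ,
    show (fun s : ℂ ↦ (s - 1) * classGroupLFunction₀ K χ s) =
      (fun s : ℂ ↦ s - 1) * classGroupLFunction₀ K χ from rfl,
    analyticOrderAt_mul hsub ((differentiable_classGroupLFunction₀ χ).analyticAt z)]
  have h0 : analyticOrderAt (fun s : ℂ ↦ s - 1) z = 0 := by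
    rw [hsub.analyticOrderAt_eq_zero]
    exact sub_ne_zero.mpr hz
  rw [h0, zero_add]

/-! ### The inequality at height `0` -/

/-- **`Re(−L'/L)(σ, χ) ≤ −2/(σ − β) + 77760 M_K(0)` for `1 < σ ≤ 2`** when `χ ≠ 1` and `β ∈ [1/16, 1)`
is a point with `ord_β L₀(·, χ) ≥ 2`: the local partial fraction of `Z₁_χ'/Z₁_χ` at height
`0` with true multiplicities, the zero `ρ = 1` of `Z₁_χ` cancelling `1/(σ − 1)`, the zero `β`
contributing `≥ 2/(σ − β)`, all other zeros dropped. [cite: MontgomeryVaughan2007, Theorem 11.3 (proof, Case 4)] -/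
theorem re_LSeries_twistVonMangoldt_ofReal_le_of_doubleZero {χ : ClassGroup (𝓞 K) →* ℂˣ} (hχ : χ ≠ 1)
    {β : ℝ} (hβ0 : 1 / 16 ≤ β) (hβ1 : β < 1)
    (hord : (2 : ℕ∞) ≤ analyticOrderAt (classGroupLFunction₀ K χ) β)
    {σ : ℝ} (hσ : 1 < σ) (hσ2 : σ ≤ 2) :
    (LSeries (twistVonMangoldt K (classGroupCharIdealHom χ)) σ).re ≤
      -(2 / (σ - β)) + 77760 * discBound K 0 := by
  classical
  set f := classTwistedZeta₁ K (fun C ↦ (χ C : ℂ)) with hf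
  have hc2 : (2 : ℂ) + ((0 : ℝ) : ℂ) * I = 2 := by simp
  have hs : 1 < ((σ : ℂ)).re := by simpa using hσ
  have hsc : (σ : ℂ) ∈ closedBall ((2 : ℂ) + ((0 : ℝ) : ℂ) * I) (7 / 4) := by
    rw [mem_closedBall, dist_eq_norm, hc2, show (σ : ℂ) - 2 = ((σ - 2 : ℝ) : ℂ) by push_cast; ring,
      Complex.norm_real, Real.norm_eq_abs, abs_le]
    constructor <;> linarith
  have hfs : f σ ≠ 0 := classTwistedZeta₁_ne_zero_of_one_lt_re χ hs
  have hpf := norm_logDeriv_classTwistedZeta₁_sub_sum_le χ 0 hsc hfs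
  set D := divisor f (closedBall ((2 : ℂ) + ((0 : ℝ) : ℂ) * I) (31 / 16)) with hD
  set S := (D.finiteSupport (isCompact_closedBall _ _)).toFinset with hS
  have han := analyticOnNhd_classTwistedZeta₁ (K := K) (fun C ↦ (χ C : ℂ))
    (closedBall ((2 : ℂ) + ((0 : ℝ) : ℂ) * I) (31 / 16))
  -- non-negativity of all terms
  have hterm_re : ∀ u : ℂ, ((D u : ℂ) / ((σ : ℂ) - u)).re = (D u : ℝ) * (((σ : ℂ) - u)⁻¹).re := fun u ↦ by
    rw [div_eq_mul_inv, show ((D u : ℤ) : ℂ) = ((D u : ℝ) : ℂ) by simp, Complex.re_ofReal_mul]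
  have hDnn : ∀ u, (0 : ℝ) ≤ D u := fun u ↦ by exact_mod_cast han.divisor_nonneg u
  have hinv_nn : ∀ u ∈ S, 0 ≤ (((σ : ℂ) - u)⁻¹).re := by
    intro u hu
    rw [hS, Set.Finite.mem_toFinset, Function.mem_support] at hu
    have huB : u ∈ closedBall ((2 : ℂ) + ((0 : ℝ) : ℂ) * I) (31 / 16) :=
      D.supportWithinDomain (Function.mem_support.2 hu)
    have hfu : f u = 0 := by
      rw [hD, divisor_apply han.meromorphicOn huB,
        ((differentiable_classTwistedZeta₁ _).analyticAt u).meromorphicOrderAt_eq] at hu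
      by_contra hne
      apply hu
      rw [((differentiable_classTwistedZeta₁ _).analyticAt u).analyticOrderAt_eq_zero.2 hne]
      simp
    have hure := re_le_one_of_classTwistedZeta₁_eq_zero χ hfu
    rw [Complex.inv_re]
    exact div_nonneg (by simp; linarith) (Complex.normSq_nonneg _)
  have hterm_nn : ∀ u ∈ S, 0 ≤ ((D u : ℂ) / ((σ : ℂ) - u)).re := fun u hu ↦ by
    rw [hterm_re u]; exact mul_nonneg (hDnn u) (hinv_nn u hu)
  -- the two special zeros: `1` (multiplicity ≥ 1) and `β` (multiplicity ≥ 2)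
  have h1B : (1 : ℂ) ∈ closedBall ((2 : ℂ) + ((0 : ℝ) : ℂ) * I) (31 / 16) := by
    rw [hc2, mem_closedBall, dist_eq_norm]; norm_num
  have hβB : (β : ℂ) ∈ closedBall ((2 : ℂ) + ((0 : ℝ) : ℂ) * I) (31 / 16) := by
    rw [hc2, mem_closedBall, dist_eq_norm, show (β : ℂ) - 2 = ((β - 2 : ℝ) : ℂ) by push_cast; ring,
      Complex.norm_real, Real.norm_eq_abs, abs_le]
    constructor <;> linarith
  have hD1 : 1 ≤ D 1 := one_le_divisor_classTwistedZeta₁_one hχ h1B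
  have hβne : (β : ℂ) ≠ 1 := fun h ↦ by
    have := congrArg Complex.re h; simp at this; linarith
  have hDβ : 2 ≤ D β := by
    have hordZ : (2 : ℕ∞) ≤ analyticOrderAt f β := by
      rw [hf, analyticOrderAt_classTwistedZeta₁_eq hχ hβne]; exact hord
    have := natCast_le_divisor_of_le_analyticOrderAt han hβB (k := 2) (by exact_mod_cast hordZ)
      (analyticOrderAt_classTwistedZeta₁_ne_top χ β)
    exact_mod_cast this
  have h1S : (1 : ℂ) ∈ S := by
    rw [hS, Set.Finite.mem_toFinset, Function.mem_support]; omega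
  have hβS : (β : ℂ) ∈ S := by
    rw [hS, Set.Finite.mem_toFinset, Function.mem_support]; omega
  have hne1β : (1 : ℂ) ≠ (β : ℂ) := fun h ↦ hβne h.symm
  -- `Re Σ ≥ D(1) Re 1/(σ-1) + D(β) Re 1/(σ-β) ≥ 1/(σ-1) + 2/(σ-β)`
  have e1 : (((σ : ℂ) - 1)⁻¹).re = 1 / (σ - 1) := by
    rw [show (σ : ℂ) - 1 = ((σ - 1 : ℝ) : ℂ) by push_cast; ring, ← Complex.ofReal_inv, Complex.ofReal_re,
      one_div]
  have eβ : (((σ : ℂ) - β)⁻¹).re = 1 / (σ - β) := by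
    rw [show (σ : ℂ) - β = ((σ - β : ℝ) : ℂ) by push_cast; ring, ← Complex.ofReal_inv, Complex.ofReal_re,
      one_div]
  have hsum_ge : 1 / (σ - 1) + 2 / (σ - β) ≤ (∑ u ∈ S, (D u : ℂ) / ((σ : ℂ) - u)).re := by
    rw [Complex.re_sum]
    have hsub : ({1, (β : ℂ)} : Finset ℂ) ⊆ S := by
      intro u hu
      rw [Finset.mem_insert, Finset.mem_singleton] at hu
      rcases hu with rfl | rfl
      · exact h1S
      · exact hβS
    have hpair := Finset.sum_le_sum_of_subset_of_nonneg hsub (fun u hu _ ↦ hterm_nn u hu)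
    rw [Finset.sum_pair hne1β, hterm_re, hterm_re, e1, eβ] at hpair
    have hD1' : (1 : ℝ) ≤ D 1 := by exact_mod_cast hD1
    have hDβ' : (2 : ℝ) ≤ D β := by exact_mod_cast hDβ
    have hp1 : 0 < 1 / (σ - 1) := by positivity
    have hpβ : 0 < 1 / (σ - β) := one_div_pos.mpr (by linarith)
    have : 1 / (σ - 1) + 2 / (σ - β) ≤ (D 1 : ℝ) * (1 / (σ - 1)) + (D β : ℝ) * (1 / (σ - β)) := by
      rw [show 2 / (σ - β) = 2 * (1 / (σ - β)) by ring]
      nlinarith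
    exact this.trans hpair
  -- assemble
  have hL : LSeries (twistVonMangoldt K (classGroupCharIdealHom χ)) σ =
      1 / ((σ : ℂ) - 1) - (∑ u ∈ S, (D u : ℂ) / ((σ : ℂ) - u)) -
        (logDeriv f σ - ∑ u ∈ S, (D u : ℂ) / ((σ : ℂ) - u)) := by
    rw [logDeriv_classTwistedZeta₁_eq χ hs]; ring
  have hre1 : (1 / ((σ : ℂ) - 1)).re = 1 / (σ - 1) := by rw [one_div, e1]
  rw [hL, Complex.sub_re, Complex.sub_re, hre1]
  have h1 := Complex.abs_re_le_norm (logDeriv f σ - ∑ u ∈ S, (D u : ℂ) / ((σ : ℂ) - u))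
  have h2 := neg_abs_le (logDeriv f σ - ∑ u ∈ S, (D u : ℂ) / ((σ : ℂ) - u)).re
  linarith

/-! ### Simplicity of the exceptional zero -/

/-- **The exceptional zero is simple, uniformly in the field** ([ThornerZaman2019, Theorem 3.1],
multiplicity clause; MV Theorem 11.3): for every `n` there is `c = c(n) > 0` such that for every
number field `K` of degree `n`, every class group character `χ ≠ 1` and every real zero `β` of
`L₀(s, χ)` of order at least `2`, `β ≤ 1 − c/(log|d_K| + log 4)`. Proof: MV Case 4 with the zero
counted twice — `0 ≤ L(Λ_K, σ) + Re L(Λ_χ, σ) ≤ 1/(σ−1) + K₀ℒ₀ − 2/(σ−β) + K'ℒ₀` at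
`σ = 1 + 2(1 − β)` gives `1/(6(1−β)) ≤ (K₀ + K')ℒ₀`. [cite: MontgomeryVaughan2007, Theorem 11.3] -/
theorem exists_realZero_simple_classGroupLFunction₀ (n : ℕ) :
    ∃ c : ℝ, 0 < c ∧ ∀ (K : Type) [Field K] [NumberField K], Module.finrank ℚ K = n →
      ∀ χ : ClassGroup (𝓞 K) →* ℂˣ, χ ≠ 1 → ∀ β : ℝ, classGroupLFunction₀ K χ β = 0 →
        (2 : ℕ∞) ≤ analyticOrderAt (classGroupLFunction₀ K χ) β →
          β ≤ 1 - c / (Real.log ((discr K).natAbs : ℝ) + Real.log 4) := by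
  set Kc : ℝ := 77760 * (5 * n + 2) with hKc
  have hKc0 : 0 ≤ Kc := by positivity
  set c : ℝ := min (1 / 4) (1 / (6 * (2 * Kc + 1))) with hcdef
  have hc : 0 < c := lt_min (by norm_num) (by positivity)
  have hc4 : c ≤ 1 / 4 := min_le_left _ _
  have hcK : c ≤ 1 / (6 * (2 * Kc + 1)) := min_le_right _ _
  refine ⟨c, hc, fun K _ _ hK χ hχ β hzero hord ↦ ?_⟩
  subst hK
  set ℒ₀ : ℝ := Real.log ((discr K).natAbs : ℝ) + Real.log 4 with hℒ₀
  have hd1 : (1 : ℝ) ≤ ((discr K).natAbs : ℝ) := by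
    have h := Int.one_le_abs (NumberField.discr_ne_zero K)
    rw [Int.abs_eq_natAbs] at h
    exact_mod_cast h
  have hℒ₀1 : 1 ≤ ℒ₀ := UniformTwistedZFRData.log_add_log_four_ge hd1
  have hℒ₀0 : 0 < ℒ₀ := by linarith
  have hcℒ : c / ℒ₀ ≤ c := div_le_self hc.le hℒ₀1
  have hβ1 : β < 1 := realZero_lt_one hχ hzero
  set u : ℝ := 1 - β with hu
  have hu0 : 0 < u := by rw [hu]; linarith
  by_contra hcon
  rw [not_le] at hcon
  have hularge : u < c / ℒ₀ := by rw [hu]; linarith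
  have husmall : u < 1 / 4 := by linarith
  have hβ0 : 1 / 16 ≤ β := by linarith
  -- `σ = 1 + 2u`
  set σ : ℝ := 1 + 2 * u with hσdef
  have hσ1 : 1 < σ := by rw [hσdef]; linarith
  have hσ2 : σ ≤ 2 := by rw [hσdef]; linarith
  have hB := re_LSeries_twistVonMangoldt_ofReal_le_of_doubleZero hχ hβ0 hβ1 hord hσ1 hσ2
  have hA := re_LSeries_vonMangoldtNorm_ofReal_le (K := K) hσ1 hσ2
  have h114 := TwistedZFR.re_add_re_nonneg (norm_twistVonMangoldt_le (norm_classGroupCharIdealHom_le χ))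
    (fun s hs ↦ LSeriesSummable_vonMangoldtNorm hs) hσ1
  have hM := discBound_zero_le (K := K)
  -- combine: `2/(σ−β) − 1/(σ−1) ≤ (Kc + Kc) ℒ₀`
  have hkey : 2 / (σ - β) - 1 / (σ - 1) ≤ 2 * Kc * ℒ₀ := by
    have : 77760 * discBound K 0 ≤ Kc * ℒ₀ := by rw [hKc]; nlinarith
    nlinarith
  have hval : 2 / (σ - β) - 1 / (σ - 1) = 1 / (6 * u) := by
    have e1 : σ - β = 3 * u := by rw [hσdef, hu]; ring
    have e2 : σ - 1 = 2 * u := by rw [hσdef]; ring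
    have hu' : u ≠ 0 := hu0.ne'
    rw [e1, e2]
    field_simp
    norm_num
  rw [hval] at hkey
  have hc' : c * (6 * (2 * Kc + 1)) ≤ 1 := by
    rw [le_div_iff₀ (by positivity)] at hcK; linarith
  have hfinal : c / ℒ₀ ≤ u := by
    rw [div_le_iff₀ hℒ₀0]
    rw [div_le_iff₀ (by positivity)] at hkey
    nlinarith
  linarith

end Literature.NumberTheory.LFunctions.NumberField

end
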